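import Summits.QuantumFields.YangMills.Theorems.BalabanUVNodesN07CritTangentConverse
import Summits.QuantumFields.YangMills.Theorems.UnitScaleTiltProp7NestedMeanParallelLiftDiagSplit
import Summits.QuantumFields.YangMills.Theorems.UnitScaleTiltProp7SymCentreAbelianFibre
import Literature.MathematicalPhysics.QuantumFieldTheory.Balaban1983to89.T4AdjointCovarianceUnitary
import HarnessLib

/-!
# S2β · SYMMETRIC CRITICALITY AT A σ₃-DIAGONAL CONFIGURATION (Palais' principle for the one element `c₀ = diag(i, −i) = iσ₃ ∈ SU(2)`):
# ABELIAN TANGENT-CRITICALITY ⟹ TANGENT-CRITICALITY ⟹ CURVE-CRITICALITY (print's «critical configuration of (5) on 𝔅_k(V)»)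

Cell `ym3-torus` (YM ladder rung R3 = continuum `SU(2)` Yang–Mills on the three-torus at fixed lattice data — a RUNG: NOT d = 4, NOT infinite volume,
NOT a mass gap, NOT Clay).  Width seat `ym3-torus-px12` (gen 21), pen (B) «ABELIAN STRATUM» (★★OWNER g41 №281 one copy); crux `stmt-QuantumFields-20520`
(`…Theses.UnitScaleTilt.FluctuationComparisonRegPrIntL`), LINE S2β; `--kind proof --supports stmt-QuantumFields-20520 --as helper`: count-neutral, DEFINITION-FREE
(0 `def`, 0 `instance`, 0 `notation`, 0 `sorry`, default heartbeats).

WHY.  After ✓px17 pen 4 (`…S2BetaCriticalOrbitUnique`: [Balaban1985Variational] Prop. 7 cl. 1 at every datum with CENTRAL stabiliser) and the flat∕central data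
(✓`Prop7FlatDatum`, ✓`Prop7FlatRigidity`), the only data where Prop. 7 cl. 1 (print's (4)-edition), hence (E) ∕ ISOL∘ ∕ the residual (T)-chain, are not tree
theorems are the genuinely ABELIAN ones (σ₃-diagonal after a coarse gauge, case A of ✓`parallelConstDiag_or_loopHol_central`).  There pen 4's
`sameOrbit_of_symmetriesLift_five` wants the lift property of the CRITICAL point, which ✓`hLift_of_mem_fibre_of_parallelConstDiag` (19200 SYM-CENTRE line)
provides as soon as the critical point is a σ₃-DIAGONAL regular fibre point.  The bridge «the abelian constrained minimiser is a critical point of the FULL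
problem» is Palais' principle of symmetric criticality for the symmetry `U ↦ c₀ • U` (conjugation of every bond variable by `c₀ = iσ₃`): its fixed
configurations are exactly the σ₃-diagonal ones, `Ad c₀` fixes the diagonal part and NEGATES the off-diagonal part of every `2 × 2` matrix, the Wilson action
and the (0.4) averaging of record are `c₀`-covariant.  THIS FILE proves the TANGENT form of that principle on a generic torus `P` (the shape of ✓n07-e's
`curveCritical_of_tangentCritical`, which then upgrades it to the CURVE form = the `hEL` binder of ✓`orbitGrowth_of_regular_five`).

WHAT (generic `P : Params`, `k ≤ m + K`, group `SU(2)`, averaging of record `blockAvg expMeanLogSU`).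
* §1 `c₀ = iσ₃` as an element of `SU(2)`; `c₀ M c₀⋆ = σ₃ M σ₃` has the off-diagonal entries of `M` negated, so `M + c₀ M c₀⋆` commutes with `σ₃`; a σ₃-diagonal
  bond variable commutes with `c₀`; the constant gauge transformation `c₀` is its own `transfUp` at every level.
* §2 `expChart_conj`: at a σ₃-diagonal `U`, `c₀ • (U·e^{tX}) = U·e^{t·Ad_{c₀}X}` (the symmetry acts on the chart directions by `Ad c₀`); `iter_gaugeAct_const`:
  `Ū^k(c₀ • W) = c₀ • Ū^k(W)` ([Balaban1985Averaging] (11)).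
* §3 ★★ `tangentCritical_of_abelianTangentCritical`: at a σ₃-diagonal `U` with `t₀`-small iterated averages, IF `d∕dt A(U·e^{tX})|₀ = 0` for every
  σ₃-DIAGONAL kernel direction `X` of the linearised `k`-fold averaging, THEN the same holds for EVERY kernel direction `X : bonds → 𝔰𝔲(2)`.  Proof: `X′ := Ad_{c₀}X`
  is a kernel direction (covariance) with the same action derivative `a` (invariance); `X + X′` is a DIAGONAL kernel direction (the Fréchet derivative of
  ✓`Node00.AveragingSmooth.iterM` is linear) whose action derivative is `a + a` (the first variation ✓`Node00.hasDerivAt_wilsonAction4` is additive in the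
  velocity) and `0` by hypothesis; so `a = 0`.
* §4 ★★ `curveCritical_of_abelianTangentCritical`: composition with ✓`curveCritical_of_tangentCritical` — the CURVE form (E–L along every bond-wise
  differentiable family with `Ū^k` constant near `0`).

HONEST.  Finite-dimensional calculus about the tree's own objects at ONE configuration; the abelian tangent-criticality is a HYPOTHESIS here (its supplier from
an abelian constrained minimiser and the Prop-7 assembly are the sibling files); nothing of Bałaban's analysis is asserted; Prop. 7 cl. 1 at abelian data, (E),
ISOL∘, TUBE-REG∘, GAP♯∘, EXW∘, S2β and crux 20520 are NOT proved; rung R3 = `YM3TorusSU2` as filed — SU(2) YM₃ on T³; the Yang–Mills mass gap is NOT proved.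
Sorry-free, axioms standard.
[cite: Balaban1985Variational, (4)-(5) p.278, (82)-(83) p.290, (111) p.294, Prop. 7 p.299; Balaban1985Averaging, (8) and (11) p.19; Balaban1987RG1, (0.4) p.253, (0.21) p.256]
-/

set_option autoImplicit false

noncomputable section

open scoped Matrix.Norms.L2Operator Topology
open Filter Function NormedSpace
open Literature.MathematicalPhysics.QuantumFieldTheory.Balaban1983to89
open Literature.MathematicalPhysics.QuantumFieldTheory.Balaban1983to89.T4Continuum
open Literature.MathematicalPhysics.QuantumFieldTheory.Balaban1983to89.BlockAveraging (blockAvg)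
open Literature.MathematicalPhysics.QuantumFieldTheory.Balaban1983to89.ExpMeanLog (expMeanLogSU deltaSU)
open Literature.MathematicalPhysics.QuantumFieldTheory.Balaban1983to89.T4AdjointCovarianceUnitary (lieSU mem_lieSU_iff conj_mem_lieSU toUnitary coe_toUnitary)
open Literature.MathematicalPhysics.QuantumFieldTheory.Balaban1983to89.B9AdOrthogonal (σ₃)
open Literature.MathematicalPhysics.QuantumFieldTheory.Balaban1983to89.Node00
open Summit.QuantumFields.YangMills.Theorems.BlockAvgCorrector (stokesConst)
open Summit.QuantumFields.YangMills.BalabanUVNodes.N07CritTangentConverse (hasDerivAt_coeField_iter curveCritical_of_tangentCritical)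
open Summit.QuantumFields.YangMills.Theorems.Prop7NestedMeanParallelLiftDiagGauge
  (sigma3_eq apply01_eq_zero_of_commute_sigma3 apply10_eq_zero_of_commute_sigma3 commute_sigma3_of_apply_eq_zero star_sigma3)
open Summit.QuantumFields.YangMills.Theorems.Prop7SymCentreAbelianFibre (I_smul_sigma3_eq_diagonal)

namespace Summit.QuantumFields.YangMills.Theorems.FluctuationComparisonRegPrIntLS2BetaAbelianSymmetricCriticality

/-! ## §1 The symmetry `c₀ = iσ₃ ∈ SU(2)` and its action on `2 × 2` matrices -/

section Algebra

/-- `iσ₃ = diag(i, −i)` is special unitary. [folklore] -/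
theorem I_smul_sigma3_mem_specialUnitaryGroup : (Complex.I • σ₃ : Matrix (Fin 2) (Fin 2) ℂ) ∈ Matrix.specialUnitaryGroup (Fin 2) ℂ := by
  rw [Matrix.mem_specialUnitaryGroup_iff, Matrix.mem_unitaryGroup_iff, sigma3_eq]
  constructor
  · ext i j
    fin_cases i <;> fin_cases j <;> simp [Matrix.mul_apply, Fin.sum_univ_two, Matrix.star_apply]
  · simp [Matrix.det_fin_two]

/-- `(iσ₃)⋆ · (iσ₃) = 1`. [folklore] -/
theorem star_I_smul_sigma3_mul_self : star (Complex.I • σ₃ : Matrix (Fin 2) (Fin 2) ℂ) * (Complex.I • σ₃) = 1 := by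
  rw [sigma3_eq]; ext i j
  fin_cases i <;> fin_cases j <;> simp [Matrix.mul_apply, Fin.sum_univ_two, Matrix.star_apply]

/-- `(iσ₃) · (iσ₃)⋆ = 1`. [folklore] -/
theorem I_smul_sigma3_mul_star_self : (Complex.I • σ₃ : Matrix (Fin 2) (Fin 2) ℂ) * star (Complex.I • σ₃) = 1 := by
  rw [sigma3_eq]; ext i j
  fin_cases i <;> fin_cases j <;> simp [Matrix.mul_apply, Fin.sum_univ_two, Matrix.star_apply]

/-- **`Ad_{c₀}` NEGATES THE OFF-DIAGONAL ENTRIES AND FIXES THE DIAGONAL ONES**: `(iσ₃) M (iσ₃)⋆ = [[M₀₀, −M₀₁], [−M₁₀, M₁₁]]`. [folklore] -/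
theorem conj_I_smul_sigma3_eq (M : Matrix (Fin 2) (Fin 2) ℂ) :
    (Complex.I • σ₃ : Matrix (Fin 2) (Fin 2) ℂ) * M * star (Complex.I • σ₃) = !![M 0 0, -M 0 1; -M 1 0, M 1 1] := by
  rw [I_smul_sigma3_eq_diagonal, Matrix.star_eq_conjTranspose, Matrix.diagonal_conjTranspose]
  ext i j
  rw [Matrix.mul_apply]
  simp only [Matrix.diagonal_mul, Matrix.diagonal_apply, Fin.sum_univ_two]
  fin_cases i <;> fin_cases j <;> simp
  all_goals
    first
      | linear_combination (-(M 0 0)) * Complex.I_sq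
      | linear_combination (M 0 1) * Complex.I_sq
      | linear_combination (M 1 0) * Complex.I_sq
      | linear_combination (-(M 1 1)) * Complex.I_sq

/-- Hence `M + Ad_{c₀} M` is diagonal: it commutes with `σ₃`. [folklore] -/
theorem commute_add_conj_sigma3 (M : Matrix (Fin 2) (Fin 2) ℂ) :
    Commute (M + (Complex.I • σ₃ : Matrix (Fin 2) (Fin 2) ℂ) * M * star (Complex.I • σ₃)) σ₃ := by
  rw [conj_I_smul_sigma3_eq]
  refine commute_sigma3_of_apply_eq_zero ?_ ?_ <;> simp

/-- A matrix commuting with `σ₃` commutes with `iσ₃`. [folklore] -/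
theorem commute_I_smul_sigma3_of_commute {A : Matrix (Fin 2) (Fin 2) ℂ} (hA : Commute A σ₃) :
    Commute A (Complex.I • σ₃ : Matrix (Fin 2) (Fin 2) ℂ) :=
  hA.smul_right _

/-- A matrix commuting with `σ₃` is fixed by `Ad_{c₀}`. [folklore] -/
theorem conj_eq_self_of_commute {A : Matrix (Fin 2) (Fin 2) ℂ} (hA : Commute A σ₃) :
    (Complex.I • σ₃ : Matrix (Fin 2) (Fin 2) ℂ) * A * star (Complex.I • σ₃) = A := by
  rw [(commute_I_smul_sigma3_of_commute hA).symm.eq, mul_assoc, I_smul_sigma3_mul_star_self, mul_one]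

/-- The constant gauge transformation is its own push-forward at every averaging level. [cite: Balaban1985Averaging, (11) p.19 (bookkeeping)] -/
theorem transfUp_const {P : Params} {G : Type*} [GaugeGroup G] (g : G) : ∀ k : ℕ, transfUp (P := P) (fun _ => g) k = fun _ => g
  | 0 => rfl
  | k + 1 => by
    funext y
    show transfUp (P := P) (fun _ => g) k (emb y) = g
    rw [transfUp_const g k]

end Algebra

/-! ## §2 The symmetry on charts and on the averaging of record -/

section Chart

variable {P : Params}

/-- The bond-wise conjugate `Ad_{c₀} X` of a Lie-algebra field is again a Lie-algebra field. [folklore] -/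
theorem conj_mem_lieSU_fin_two (X : Matrix (Fin 2) (Fin 2) ℂ) (hX : X ∈ lieSU (Fin 2)) :
    (Complex.I • σ₃ : Matrix (Fin 2) (Fin 2) ℂ) * X * star (Complex.I • σ₃) ∈ lieSU (Fin 2) := by
  have h := conj_mem_lieSU hX (toUnitary ⟨Complex.I • σ₃, I_smul_sigma3_mem_specialUnitaryGroup⟩)
  simpa [coe_toUnitary] using h

/-- **THE SYMMETRY ACTS ON THE CHART DIRECTIONS BY `Ad c₀`**: at a σ₃-diagonal `U`, conjugating every bond variable of `U·e^{X}` by `c₀` gives `U·e^{Ad_{c₀} X}`.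
[cite: Balaban1985RegularSpaces, (1.10) p.77; Balaban1985Averaging, (8) p.19] -/
theorem gaugeAct_const_expChart {j : ℕ} (U : GaugeField P j (Matrix.specialUnitaryGroup (Fin 2) ℂ))
    (hdiag : ∀ b, Commute ((U b : Matrix.specialUnitaryGroup (Fin 2) ℂ) : Matrix (Fin 2) (Fin 2) ℂ) σ₃)
    (X X' : PBond P j → lieSU (Fin 2))
    (hX' : ∀ b, ((X' b : lieSU (Fin 2)) : Matrix (Fin 2) (Fin 2) ℂ) =
      (Complex.I • σ₃ : Matrix (Fin 2) (Fin 2) ℂ) * ((X b : lieSU (Fin 2)) : Matrix (Fin 2) (Fin 2) ℂ) * star (Complex.I • σ₃)) :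
    GaugeField.gaugeAct (fun _ => (⟨Complex.I • σ₃, I_smul_sigma3_mem_specialUnitaryGroup⟩ : Matrix.specialUnitaryGroup (Fin 2) ℂ)) (expChart U X) =
      expChart U X' := by
  funext b
  apply Subtype.ext
  -- the unit `c₀` of the matrix algebra, with inverse `c₀⋆`
  set u₀ : (Matrix (Fin 2) (Fin 2) ℂ)ˣ := ⟨Complex.I • σ₃, star (Complex.I • σ₃), I_smul_sigma3_mul_star_self, star_I_smul_sigma3_mul_self⟩ with hu₀
  have hcoeL : (((GaugeField.gaugeAct (fun _ => (⟨Complex.I • σ₃, I_smul_sigma3_mem_specialUnitaryGroup⟩ : Matrix.specialUnitaryGroup (Fin 2) ℂ))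
      (expChart U X) b : Matrix.specialUnitaryGroup (Fin 2) ℂ)) : Matrix (Fin 2) (Fin 2) ℂ) =
      (Complex.I • σ₃ : Matrix (Fin 2) (Fin 2) ℂ) * (((U b : Matrix.specialUnitaryGroup (Fin 2) ℂ) : Matrix (Fin 2) (Fin 2) ℂ) *
        NormedSpace.exp (((X b : lieSU (Fin 2)) : Matrix (Fin 2) (Fin 2) ℂ))) * star (Complex.I • σ₃ : Matrix (Fin 2) (Fin 2) ℂ) := rfl
  have hcoeR : (((expChart U X' b : Matrix.specialUnitaryGroup (Fin 2) ℂ)) : Matrix (Fin 2) (Fin 2) ℂ) =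
      (((U b : Matrix.specialUnitaryGroup (Fin 2) ℂ) : Matrix (Fin 2) (Fin 2) ℂ)) * NormedSpace.exp (((X' b : lieSU (Fin 2)) : Matrix (Fin 2) (Fin 2) ℂ)) := rfl
  rw [hcoeL, hcoeR, hX' b]
  have hexp : NormedSpace.exp ((Complex.I • σ₃ : Matrix (Fin 2) (Fin 2) ℂ) * ((X b : lieSU (Fin 2)) : Matrix (Fin 2) (Fin 2) ℂ) * star (Complex.I • σ₃)) =
      (Complex.I • σ₃ : Matrix (Fin 2) (Fin 2) ℂ) * NormedSpace.exp (((X b : lieSU (Fin 2)) : Matrix (Fin 2) (Fin 2) ℂ)) * star (Complex.I • σ₃) := by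
    letI : NormedAlgebra ℚ (Matrix (Fin 2) (Fin 2) ℂ) := NormedAlgebra.restrictScalars ℚ ℂ (Matrix (Fin 2) (Fin 2) ℂ)
    have h := NormedSpace.exp_units_conj u₀ (((X b : lieSU (Fin 2)) : Matrix (Fin 2) (Fin 2) ℂ))
    simpa [hu₀] using h
  rw [hexp]
  have hc : (((U b : Matrix.specialUnitaryGroup (Fin 2) ℂ) : Matrix (Fin 2) (Fin 2) ℂ)) * (Complex.I • σ₃ : Matrix (Fin 2) (Fin 2) ℂ) =
      (Complex.I • σ₃ : Matrix (Fin 2) (Fin 2) ℂ) * (((U b : Matrix.specialUnitaryGroup (Fin 2) ℂ) : Matrix (Fin 2) (Fin 2) ℂ)) :=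
    (commute_I_smul_sigma3_of_commute (hdiag b)).eq
  simp only [← mul_assoc]
  rw [hc]

/-- **THE AVERAGING OF RECORD COMMUTES WITH THE SYMMETRY** (`k ≤ m + K`): `Ū^k(c₀ • W) = c₀ • Ū^k(W)` for the constant gauge transformation `c₀` (covariance (11),
iterated, with `transfUp` of a constant constant). [cite: Balaban1985Averaging, (11) p.19; Balaban1987RG1, (0.21) p.256] -/
theorem iter_gaugeAct_const {G : Type*} [GaugeGroup G] (av : ∀ j, Averaging P j G) (g : G) {k : ℕ} (hk : k ≤ P.m + P.K) (W : GaugeField P 0 G) :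
    Averaging.iter av k (GaugeField.gaugeAct (fun _ => g) W) = GaugeField.gaugeAct (fun _ => g) (Averaging.iter av k W) := by
  rw [iter_gaugeAct av (fun _ => g) k hk W, transfUp_const]

end Chart

/-! ## §3 The first variation is additive in the velocity; symmetric criticality, tangent form -/

section FirstVariation

variable {P : Params} {j : ℕ} {N : ℕ} [NeZero N]

/-- **THE FIRST VARIATION OF (5) IS ADDITIVE IN THE VELOCITY**: three families through one configuration with bond-wise velocities `Y₁`, `Y₂`, `Y₁ + Y₂` have action
derivatives `a₁`, `a₂`, `a₁ + a₂` (✓`Node00.hasDerivAt_wilsonAction4`: the derivative is the four-term Leibniz sum, linear in the velocity).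
[cite: Balaban1985Variational, (5) p.278 (bookkeeping)] -/
theorem hasDerivAt_wilsonAction4_add_velocity {γ₁ γ₂ γ₃ : ℝ → GaugeField P j (Matrix.specialUnitaryGroup (Fin N) ℂ)}
    (h₁₃ : γ₁ 0 = γ₃ 0) (h₂₃ : γ₂ 0 = γ₃ 0) {Y₁ Y₂ : PBond P j → Matrix (Fin N) (Fin N) ℂ}
    (h₁ : ∀ b, HasDerivAt (fun t => ((γ₁ t b : Matrix.specialUnitaryGroup (Fin N) ℂ) : Matrix (Fin N) (Fin N) ℂ)) (Y₁ b) 0)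
    (h₂ : ∀ b, HasDerivAt (fun t => ((γ₂ t b : Matrix.specialUnitaryGroup (Fin N) ℂ) : Matrix (Fin N) (Fin N) ℂ)) (Y₂ b) 0)
    (h₃ : ∀ b, HasDerivAt (fun t => ((γ₃ t b : Matrix.specialUnitaryGroup (Fin N) ℂ) : Matrix (Fin N) (Fin N) ℂ)) (Y₁ b + Y₂ b) 0)
    {a₁ a₂ : ℝ} (ha₁ : HasDerivAt (fun t => wilsonAction4 (γ₁ t)) a₁ 0) (ha₂ : HasDerivAt (fun t => wilsonAction4 (γ₂ t)) a₂ 0) :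
    HasDerivAt (fun t => wilsonAction4 (γ₃ t)) (a₁ + a₂) 0 := by
  have e₁ := fun p => hasDerivAt_coe_plaqHol h₁ p
  have e₂ := fun p => hasDerivAt_coe_plaqHol h₂ p
  have e₃ := fun p => hasDerivAt_coe_plaqHol h₃ p
  -- the plaquette derivatives along `γ₃` are the sums of those along `γ₁`, `γ₂`
  have hM : ∀ p : Plaq P j, HasDerivAt (fun t => ((GaugeField.plaqHol (γ₃ t) p : Matrix.specialUnitaryGroup (Fin N) ℂ) : Matrix (Fin N) (Fin N) ℂ))
      (deriv (fun t => ((GaugeField.plaqHol (γ₁ t) p : Matrix.specialUnitaryGroup (Fin N) ℂ) : Matrix (Fin N) (Fin N) ℂ)) 0 +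
        deriv (fun t => ((GaugeField.plaqHol (γ₂ t) p : Matrix.specialUnitaryGroup (Fin N) ℂ) : Matrix (Fin N) (Fin N) ℂ)) 0) 0 := by
    intro p
    rw [(e₁ p).deriv, (e₂ p).deriv, h₁₃, h₂₃]
    refine (e₃ p).congr_deriv ?_
    simp only [star_add]
    noncomm_ring
  have e₁' := hasDerivAt_wilsonAction4 h₁ e₁
  have e₂' := hasDerivAt_wilsonAction4 h₂ e₂
  have e₃' := hasDerivAt_wilsonAction4 h₃ hM
  rw [ha₁.unique e₁', ha₂.unique e₂']
  refine e₃'.congr_deriv ?_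
  simp only [(e₁ _).deriv, (e₂ _).deriv, h₁₃, h₂₃, map_add, Complex.add_re, add_div, neg_add, Finset.sum_add_distrib]

end FirstVariation

section Tangent

variable {P : Params}

/-- ★★ **SYMMETRIC CRITICALITY AT A σ₃-DIAGONAL CONFIGURATION, TANGENT FORM.**  On a torus `P`, at a σ₃-diagonal `U` (`hdiag`) whose iterated averages of record are
`t₀`-small below `k` (`stokesConst·t₀ < δ₂`, `k ≤ m + K`): if `d∕dt A(U·e^{tX})|₀ = 0` for every σ₃-DIAGONAL kernel direction `X` of the linearised `k`-fold averaging
(`habel`, the abelian Euler–Lagrange condition), then `d∕dt A(U·e^{tX})|₀ = 0` for EVERY kernel direction `X : bonds → 𝔰𝔲(2)` (print's tangent form (82) of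
«critical configuration of (5) on 𝔅_k(V)»).  Palais' principle for `c₀ = iσ₃`: `X′ := Ad_{c₀}X` is a kernel direction with the same action derivative `a`
(covariance ∕ invariance), `X + X′` is a diagonal kernel direction (linearity of the Fréchet derivative of ✓`iterM`) with action derivative `a + a` (§3 additivity)
and `0` (`habel`), so `a = 0`. [cite: Balaban1985Variational, (4)-(5) p.278, (82)-(83) p.290, Prop. 7 p.299; Balaban1985Averaging, (8), (11) p.19; Balaban1987RG1, (0.4) p.253] -/
theorem tangentCritical_of_abelianTangentCritical {k : ℕ} (hk : k ≤ P.m + P.K) {t₀ : ℝ} (ht₀ : 0 < t₀)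
    (hstδ : stokesConst P * t₀ < deltaSU (Fin 2)) {U : GaugeField P 0 (Matrix.specialUnitaryGroup (Fin 2) ℂ)}
    (hsm : ∀ i, i < k → PlaqSmall t₀ (Averaging.iter (fun i => blockAvg (P := P) (j := i) (expMeanLogSU (n := Fin 2))) i U))
    (hdiag : ∀ b, Commute ((U b : Matrix.specialUnitaryGroup (Fin 2) ℂ) : Matrix (Fin 2) (Fin 2) ℂ) σ₃)
    (habel : ∀ X : PBond P 0 → lieSU (Fin 2), (∀ b, Commute ((X b : lieSU (Fin 2)) : Matrix (Fin 2) (Fin 2) ℂ) σ₃) →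
      (∀ c : PBond P k, HasDerivAt (fun t : ℝ => ((Averaging.iter (fun i => blockAvg (P := P) (j := i) (expMeanLogSU (n := Fin 2))) k
        (expChart U (t • X)) c : Matrix.specialUnitaryGroup (Fin 2) ℂ) : Matrix (Fin 2) (Fin 2) ℂ)) 0 0) →
      HasDerivAt (fun t : ℝ => wilsonAction4 (expChart U (t • X))) 0 0) :
    ∀ X : PBond P 0 → lieSU (Fin 2),
      (∀ c : PBond P k, HasDerivAt (fun t : ℝ => ((Averaging.iter (fun i => blockAvg (P := P) (j := i) (expMeanLogSU (n := Fin 2))) k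
        (expChart U (t • X)) c : Matrix.specialUnitaryGroup (Fin 2) ℂ) : Matrix (Fin 2) (Fin 2) ℂ)) 0 0) →
      HasDerivAt (fun t : ℝ => wilsonAction4 (expChart U (t • X))) 0 0 := by
  intro X hX
  -- the symmetry as a constant gauge transformation
  set c₀ : Matrix.specialUnitaryGroup (Fin 2) ℂ := ⟨Complex.I • σ₃, I_smul_sigma3_mem_specialUnitaryGroup⟩ with hc₀
  -- the conjugate direction `X′ = Ad_{c₀} X`
  set X' : PBond P 0 → lieSU (Fin 2) := fun b =>
    ⟨(Complex.I • σ₃ : Matrix (Fin 2) (Fin 2) ℂ) * ((X b : lieSU (Fin 2)) : Matrix (Fin 2) (Fin 2) ℂ) * star (Complex.I • σ₃ : Matrix (Fin 2) (Fin 2) ℂ),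
      conj_mem_lieSU_fin_two _ (X b).2⟩ with hX'def
  have hX'coe : ∀ b, ((X' b : lieSU (Fin 2)) : Matrix (Fin 2) (Fin 2) ℂ) =
      (Complex.I • σ₃ : Matrix (Fin 2) (Fin 2) ℂ) * ((X b : lieSU (Fin 2)) : Matrix (Fin 2) (Fin 2) ℂ) * star (Complex.I • σ₃ : Matrix (Fin 2) (Fin 2) ℂ) :=
    fun b => rfl
  -- the ray along `X′` is the conjugate of the ray along `X`
  have hray : ∀ t : ℝ, expChart U (t • X') = GaugeField.gaugeAct (fun _ => c₀) (expChart U (t • X)) := by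
    intro t
    refine (gaugeAct_const_expChart U hdiag (t • X) (t • X') fun b => ?_).symm
    show (((t • X') b : lieSU (Fin 2)) : Matrix (Fin 2) (Fin 2) ℂ) =
      (Complex.I • σ₃ : Matrix (Fin 2) (Fin 2) ℂ) * (((t • X) b : lieSU (Fin 2)) : Matrix (Fin 2) (Fin 2) ℂ) * star (Complex.I • σ₃ : Matrix (Fin 2) (Fin 2) ℂ)
    have key : ∀ (c d x : Matrix (Fin 2) (Fin 2) ℂ) (r : ℝ), r • (c * x * d) = c * (r • x) * d := by
      intro c d x r; rw [mul_smul_comm, smul_mul_assoc]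
    rw [Pi.smul_apply, Pi.smul_apply, Submodule.coe_smul, Submodule.coe_smul, hX'coe, key]
  -- `X′` is a kernel direction
  have hX' : ∀ c : PBond P k, HasDerivAt (fun t : ℝ => ((Averaging.iter (fun i => blockAvg (P := P) (j := i) (expMeanLogSU (n := Fin 2))) k
      (expChart U (t • X')) c : Matrix.specialUnitaryGroup (Fin 2) ℂ) : Matrix (Fin 2) (Fin 2) ℂ)) 0 0 := by
    intro c
    have hfun : (fun t : ℝ => ((Averaging.iter (fun i => blockAvg (P := P) (j := i) (expMeanLogSU (n := Fin 2))) k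
        (expChart U (t • X')) c : Matrix.specialUnitaryGroup (Fin 2) ℂ) : Matrix (Fin 2) (Fin 2) ℂ)) =
        fun t : ℝ => (Complex.I • σ₃ : Matrix (Fin 2) (Fin 2) ℂ) *
          ((Averaging.iter (fun i => blockAvg (P := P) (j := i) (expMeanLogSU (n := Fin 2))) k (expChart U (t • X)) c :
            Matrix.specialUnitaryGroup (Fin 2) ℂ) : Matrix (Fin 2) (Fin 2) ℂ) * star (Complex.I • σ₃ : Matrix (Fin 2) (Fin 2) ℂ) := by
      funext t
      rw [hray t, iter_gaugeAct_const _ c₀ hk]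
      rfl
    rw [hfun]
    have h := ((hX c).const_mul (Complex.I • σ₃ : Matrix (Fin 2) (Fin 2) ℂ)).mul_const (star (Complex.I • σ₃ : Matrix (Fin 2) (Fin 2) ℂ))
    simpa using h
  -- the diagonal direction `Xs := X + X′`
  set Xs : PBond P 0 → lieSU (Fin 2) := X + X' with hXs
  have hXs_coe : ∀ b, ((Xs b : lieSU (Fin 2)) : Matrix (Fin 2) (Fin 2) ℂ) =
      ((X b : lieSU (Fin 2)) : Matrix (Fin 2) (Fin 2) ℂ) + ((X' b : lieSU (Fin 2)) : Matrix (Fin 2) (Fin 2) ℂ) := fun b => rfl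
  have hXs_diag : ∀ b, Commute ((Xs b : lieSU (Fin 2)) : Matrix (Fin 2) (Fin 2) ℂ) σ₃ := by
    intro b
    rw [hXs_coe, hX'coe]
    exact commute_add_conj_sigma3 _
  -- velocities of the rays
  have hvel : ∀ (Z : PBond P 0 → lieSU (Fin 2)) (b : PBond P 0),
      HasDerivAt (fun t : ℝ => ((expChart U (t • Z) b : Matrix.specialUnitaryGroup (Fin 2) ℂ) : Matrix (Fin 2) (Fin 2) ℂ))
        (((U b : Matrix.specialUnitaryGroup (Fin 2) ℂ) : Matrix (Fin 2) (Fin 2) ℂ) * ((Z b : lieSU (Fin 2)) : Matrix (Fin 2) (Fin 2) ℂ)) 0 :=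
    fun Z b => hasDerivAt_coe_expChart_along (U := U) (c := fun t : ℝ => t • Z) (hasDerivAt_ray Z) (zero_smul ℝ Z) b
  have hvelPi : ∀ Z : PBond P 0 → lieSU (Fin 2), HasDerivAt (fun t : ℝ => coeField (expChart U (t • Z)))
      (fun b => ((U b : Matrix.specialUnitaryGroup (Fin 2) ℂ) : Matrix (Fin 2) (Fin 2) ℂ) * ((Z b : lieSU (Fin 2)) : Matrix (Fin 2) (Fin 2) ℂ)) 0 :=
    fun Z => hasDerivAt_pi.2 (hvel Z)
  -- the Fréchet derivative of the iterated averaging kills `U·X`, `U·X′`, hence `U·Xs`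
  set D := fderiv ℝ (iterM k : (PBond P 0 → Matrix (Fin 2) (Fin 2) ℂ) → PBond P k → Matrix (Fin 2) (Fin 2) ℂ) (coeField U) with hD
  have hiterD : ∀ Z : PBond P 0 → lieSU (Fin 2),
      HasDerivAt (fun t : ℝ => coeField (Averaging.iter (fun i => blockAvg (P := P) (j := i) (expMeanLogSU (n := Fin 2))) k (expChart U (t • Z))))
        (D fun b => ((U b : Matrix.specialUnitaryGroup (Fin 2) ℂ) : Matrix (Fin 2) (Fin 2) ℂ) * ((Z b : lieSU (Fin 2)) : Matrix (Fin 2) (Fin 2) ℂ)) 0 := by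
    intro Z
    have h := hasDerivAt_coeField_iter (Γ := fun t : ℝ => expChart U (t • Z)) ht₀ hstδ (hvelPi Z) (k := k)
      (by intro i hi; simp only [zero_smul, expChart_zero]; exact hsm i hi)
    simp only [zero_smul, expChart_zero] at h
    exact h
  have hkill : ∀ Z : PBond P 0 → lieSU (Fin 2),
      (∀ c : PBond P k, HasDerivAt (fun t : ℝ => ((Averaging.iter (fun i => blockAvg (P := P) (j := i) (expMeanLogSU (n := Fin 2))) k
        (expChart U (t • Z)) c : Matrix.specialUnitaryGroup (Fin 2) ℂ) : Matrix (Fin 2) (Fin 2) ℂ)) 0 0) →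
      D (fun b => ((U b : Matrix.specialUnitaryGroup (Fin 2) ℂ) : Matrix (Fin 2) (Fin 2) ℂ) * ((Z b : lieSU (Fin 2)) : Matrix (Fin 2) (Fin 2) ℂ)) = 0 := by
    intro Z hZ
    have h0 : HasDerivAt (fun t : ℝ => coeField (Averaging.iter (fun i => blockAvg (P := P) (j := i) (expMeanLogSU (n := Fin 2))) k (expChart U (t • Z))))
        (0 : PBond P k → Matrix (Fin 2) (Fin 2) ℂ) 0 :=
      hasDerivAt_pi.2 fun c => hZ c
    exact (hiterD Z).unique h0
  have hDXs : D (fun b => ((U b : Matrix.specialUnitaryGroup (Fin 2) ℂ) : Matrix (Fin 2) (Fin 2) ℂ) * ((Xs b : lieSU (Fin 2)) : Matrix (Fin 2) (Fin 2) ℂ)) = 0 := by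
    have hsum : (fun b => ((U b : Matrix.specialUnitaryGroup (Fin 2) ℂ) : Matrix (Fin 2) (Fin 2) ℂ) * ((Xs b : lieSU (Fin 2)) : Matrix (Fin 2) (Fin 2) ℂ)) =
        (fun b => ((U b : Matrix.specialUnitaryGroup (Fin 2) ℂ) : Matrix (Fin 2) (Fin 2) ℂ) * ((X b : lieSU (Fin 2)) : Matrix (Fin 2) (Fin 2) ℂ)) +
          (fun b => ((U b : Matrix.specialUnitaryGroup (Fin 2) ℂ) : Matrix (Fin 2) (Fin 2) ℂ) * ((X' b : lieSU (Fin 2)) : Matrix (Fin 2) (Fin 2) ℂ)) := by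
      funext b
      rw [Pi.add_apply, hXs_coe, mul_add]
    rw [hsum, map_add, hkill X hX, hkill X' hX', add_zero]
  have hXs : ∀ c : PBond P k, HasDerivAt (fun t : ℝ => ((Averaging.iter (fun i => blockAvg (P := P) (j := i) (expMeanLogSU (n := Fin 2))) k
      (expChart U (t • Xs)) c : Matrix.specialUnitaryGroup (Fin 2) ℂ) : Matrix (Fin 2) (Fin 2) ℂ)) 0 0 := by
    intro c
    have h := hiterD Xs
    rw [hDXs] at h
    exact (hasDerivAt_pi.1 h) c
  -- abelian tangent-criticality along `Xs`
  have hAs : HasDerivAt (fun t : ℝ => wilsonAction4 (expChart U (t • Xs))) 0 0 := habel Xs hXs_diag hXs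
  -- the action derivatives: `a` along `X`, the same `a` along `X′` (gauge invariance), `a + a` along `Xs` (additivity)
  obtain ⟨a, eX⟩ : ∃ a : ℝ, HasDerivAt (fun t : ℝ => wilsonAction4 (expChart U (t • X))) a 0 :=
    ⟨_, hasDerivAt_wilsonAction4 (hvel X) fun p => hasDerivAt_coe_plaqHol (hvel X) p⟩
  -- along `X′`: the same function of `t` (gauge invariance of (5)), hence the same derivative `a`
  have eX' : HasDerivAt (fun t : ℝ => wilsonAction4 (expChart U (t • X'))) a 0 := by
    have hfun : (fun t : ℝ => wilsonAction4 (expChart U (t • X'))) = fun t : ℝ => wilsonAction4 (expChart U (t • X)) := by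
      funext t
      rw [hray t]
      exact T4WilsonGaugeFlatDirection.wilsonAction_gaugeAct 1 (fun _ => c₀) _
    rw [hfun]
    exact eX
  -- along `Xs`: `a + a`
  have eXs : HasDerivAt (fun t : ℝ => wilsonAction4 (expChart U (t • Xs))) (a + a) 0 := by
    refine hasDerivAt_wilsonAction4_add_velocity (γ₁ := fun t : ℝ => expChart U (t • X)) (γ₂ := fun t : ℝ => expChart U (t • X'))
      (γ₃ := fun t : ℝ => expChart U (t • Xs)) ?_ ?_ (hvel X) (hvel X') (fun b => ?_) eX eX'
    · simp only [zero_smul, expChart_zero]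
    · simp only [zero_smul, expChart_zero]
    · have h := hvel Xs b
      rw [hXs_coe, mul_add] at h
      exact h
  -- conclusion
  have h2a : a + a = 0 := eXs.unique hAs
  have ha0 : a = 0 := by linarith
  rw [ha0] at eX
  exact eX

end Tangent

/-! ## §4 The curve form -/

section Curve

variable {P : Params}

/-- ★★ **SYMMETRIC CRITICALITY, CURVE FORM**: under the hypotheses of `tangentCritical_of_abelianTangentCritical`, `U` is a critical configuration of (5) on the
fibre `𝔅_k(Ū^k(U))` in the CURVE form — along every family `γ` through `U`, differentiable at `0` as bond matrices and with `Ū^k(γ t) = Ū^k(U)` near `0`, the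
derivative of the Wilson action vanishes (✓n07-e `curveCritical_of_tangentCritical` ∘ §3). [cite: Balaban1985Variational, (3),(5) p.278, (82)-(83) p.290, (111) p.294, Prop. 7 p.299] -/
theorem curveCritical_of_abelianTangentCritical {k : ℕ} (hk : k ≤ P.m + P.K) {t₀ : ℝ} (ht₀ : 0 < t₀)
    (hstδ : stokesConst P * t₀ < deltaSU (Fin 2)) {U : GaugeField P 0 (Matrix.specialUnitaryGroup (Fin 2) ℂ)}
    (hsm : ∀ i, i < k → PlaqSmall t₀ (Averaging.iter (fun i => blockAvg (P := P) (j := i) (expMeanLogSU (n := Fin 2))) i U))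
    (hdiag : ∀ b, Commute ((U b : Matrix.specialUnitaryGroup (Fin 2) ℂ) : Matrix (Fin 2) (Fin 2) ℂ) σ₃)
    (habel : ∀ X : PBond P 0 → lieSU (Fin 2), (∀ b, Commute ((X b : lieSU (Fin 2)) : Matrix (Fin 2) (Fin 2) ℂ) σ₃) →
      (∀ c : PBond P k, HasDerivAt (fun t : ℝ => ((Averaging.iter (fun i => blockAvg (P := P) (j := i) (expMeanLogSU (n := Fin 2))) k
        (expChart U (t • X)) c : Matrix.specialUnitaryGroup (Fin 2) ℂ) : Matrix (Fin 2) (Fin 2) ℂ)) 0 0) →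
      HasDerivAt (fun t : ℝ => wilsonAction4 (expChart U (t • X))) 0 0)
    (γ : ℝ → GaugeField P 0 (Matrix.specialUnitaryGroup (Fin 2) ℂ)) (hγ0 : γ 0 = U)
    (hd : DifferentiableAt ℝ (fun (t : ℝ) (b : PBond P 0) => ((γ t b : Matrix.specialUnitaryGroup (Fin 2) ℂ) : Matrix (Fin 2) (Fin 2) ℂ)) 0)
    (hfib : ∀ᶠ t in 𝓝 (0 : ℝ), Averaging.iter (fun i => blockAvg (P := P) (j := i) (expMeanLogSU (n := Fin 2))) k (γ t) =
      Averaging.iter (fun i => blockAvg (P := P) (j := i) (expMeanLogSU (n := Fin 2))) k U)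
    {a : ℝ} (ha : HasDerivAt (fun t => wilsonAction4 (γ t)) a 0) : a = 0 :=
  curveCritical_of_tangentCritical ht₀ hstδ hsm (tangentCritical_of_abelianTangentCritical hk ht₀ hstδ hsm hdiag habel) γ hγ0 hd hfib ha

end Curve

end Summit.QuantumFields.YangMills.Theorems.FluctuationComparisonRegPrIntLS2BetaAbelianSymmetricCriticality

end
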